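import HarnessLib
import Summits.RiemannHypothesis.RiemannHypothesis.Theorems.SignConePointwiseCertEightFifths
import Summits.RiemannHypothesis.RiemannHypothesis.Theorems.SignConePointwiseIdentityH
import Summits.RiemannHypothesis.RiemannHypothesis.Theorems.SignConeUnitSlackReduction

/-!
# Route SignCone: the unit-slack sign-cone inequality UNCONDITIONALLY up to the cut-off `a ≤ 8/5`

Items stmt-RiemannHypothesis-16302 `SignConeOscillatory` (crux) and stmt-RiemannHypothesis-16301
`SignConeInequality` (target); rung `CutoffRung (8/5)` of the cutoff ladder of the crux cell
`Cruxes/SignConeInequality`. Rung at `a ≤ 8/5` — window `(-3.2, 3.2)` — from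
the kernel-checked pointwise certificate WITH DIRICHLET-SOS TAIL `pwCert85`
(`SignConePointwiseCertEightFifths*.lean`): dyadic fake weights `a ≈ (0.7163, 0.7105, 0.2701, 0.7343, 0.6689, 0.7026, 0.2871, 0.4727, 0.5373, 0.1158, 0.5469, 0.8137, 0.5886, 0.4421, 0.2998, 0.4700, 0.3047, 0.3771, 0.6680, 0.3102, 0.0002)` on the nodes `3, 4, 5, 6, 7, 8, 9, 10, 11, 12, 13, 14, 15, 16, 17, 18, 19, 20, 21, 22, 23`
(`c_n = a_n √n / 2`, a point of the dual cone `K♭_{8/5}`), whence the antecedent of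
`ConeMagnification` at the cutoff `b = 8/5` (`fakeWeight_unitSlack_eight_fifths`) and, by
`SignConeUnitSlackReduction.lean`, the route items for all `a ≤ 8/5`
(`signConeInequality_upTo_eight_fifths`, `signConeOscillatory_upTo_eight_fifths`, bodies verbatim).
-/

noncomputable section

-- `Summit.RiemannHypothesis.RiemannHypothesis.…` repeats a namespace component by design (D-0017 layout).
set_option linter.dupNamespace false
-- the certificate data (`pwCert85sos`: 50 × 60 integer Gram rows) is a deep term
set_option maxRecDepth 16384

open scoped BigOperators ComplexConjugate
open Complex MeasureTheory Set Filter

namespace Summit.RiemannHypothesis.RiemannHypothesis.Theorems.SignCone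

open Literature.NumberTheory.LFunctions

/-- The weights vanish off the node list `[3, 4, 5, 6, 7, 8, 9, 10, 11, 12, 13, 14, 15, 16, 17, 18, 19, 20, 21, 22, 23]`. [folklore] -/
theorem pwCert85_a_eq_zero {n : ℕ} (hn : n ∉ pwCert85.nodeList.toFinset) : pwCert85.a n = 0 := by
  have hn' : n ∉ ([3, 4, 5, 6, 7, 8, 9, 10, 11, 12, 13, 14, 15, 16, 17, 18, 19, 20, 21, 22, 23] : List ℕ) := fun h => hn (List.mem_toFinset.2 h)
  simp only [List.mem_cons, List.mem_nil_iff, or_false, not_or] at hn'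
  obtain ⟨h3, h4, h5, h6, h7, h8, h9, h10, h11, h12, h13, h14, h15, h16, h17, h18, h19, h20, h21, h22, h23⟩ := hn'
  have e : pwCert85.a n = (if n = 3 then 393789785755/549755813888 else if n = 4 then 390590956649/549755813888 else if n = 5 then 74244836413/274877906944 else if n = 6 then 201844343153/274877906944 else if n = 7 then 367726238971/549755813888 else if n = 8 then 386262000797/549755813888 else if n = 9 then 157807722853/549755813888 else if n = 10 then 64966409163/137438953472 else if n = 11 then 36919790881/68719476736 else if n = 12 then 63648622089/549755813888 else if n = 13 then 150326682647/274877906944 else if n = 14 then 447323059475/549755813888 else if n = 15 then 161787212193/274877906944 else if n = 16 then 3797414355/8589934592 else if n = 17 then 164810917225/549755813888 else if n = 18 then 129203492043/274877906944 else if n = 19 then 167516477783/549755813888 else if n = 20 then 207303746469/549755813888 else if n = 21 then 367232236053/549755813888 else if n = 22 then 170552942603/549755813888 else if n = 23 then 45789795/274877906944 else 0 : ℚ) := rfl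
  rw [e, if_neg h3, if_neg h4, if_neg h5, if_neg h6, if_neg h7, if_neg h8, if_neg h9, if_neg h10, if_neg h11, if_neg h12, if_neg h13, if_neg h14, if_neg h15, if_neg h16, if_neg h17, if_neg h18, if_neg h19, if_neg h20, if_neg h21, if_neg h22, if_neg h23]

/-- The fake weights of the certificate are non-negative (`c_n = a_n √n / 2`). [folklore] -/
theorem pwCert85_a_nonneg (n : ℕ) : 0 ≤ pwCert85.a n := by
  by_cases hn : n ∈ pwCert85.nodeList.toFinset
  · have hall : (pwCert85.nodeList.all fun k => decide (0 ≤ pwCert85.a k)) = true := by decide +kernel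
    rw [List.all_eq_true] at hall
    exact of_decide_eq_true (hall n (List.mem_toFinset.1 hn))
  · rw [pwCert85_a_eq_zero hn]

/-- **The antecedent of `ConeMagnification` at cut-off `8/5` with an explicit fake weight**:
`-‖g‖₂² ≤ Re (W_ar(g ⋆ g̃) − P_c(g ⋆ g̃))` for every Weil test `g` supported in `[-8/5, 8/5]`, with
`c_n = a_n √n/2` on the nodes (kernel-checked pointwise certificate `pwCert85`). [folklore] -/
theorem fakeWeight_unitSlack_eight_fifths :
    ∀ g : ℝ → ℂ, IsWeilTest g → tsupport g ⊆ Icc (-(8 / 5 : ℝ)) (8 / 5) →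
      -(∫ t, ‖g t‖ ^ 2) ≤ (weilPolarTerm (weilConv g (weilReflect g)) + weilArchTerm (weilConv g (weilReflect g)) -
        ∑' n : ℕ, (((fun n : ℕ => (pwCert85.a n : ℝ) * Real.sqrt n / 2) n : ℝ) : ℂ) / (Real.sqrt n : ℂ) *
          (weilConv g (weilReflect g) (Real.log n) + weilConv g (weilReflect g) (-Real.log n))).re := by
  intro g hg hsupp
  have hh : (0 : ℚ) < pwCert85.d.h := by show (0 : ℚ) < 1/8; norm_num
  have hL : pwCert85.d.L = 16/5 := rfl
  -- the kernel of the certificate on the window [-2b, 2b]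
  have hEeq : ∀ x ∈ Icc (-(2 * (8 / 5 : ℝ))) (2 * (8 / 5)),
      pwCert85.d.kernelE x = Real.exp (x / 2) + Real.exp (-(x / 2)) := by
    intro x hx
    refine PWKernel.kernelE_eq_of_abs_le hh ?_
    rw [hL]; push_cast
    exact abs_le.2 ⟨by linarith [hx.1], by linarith [hx.2]⟩
  -- the corrected pointwise certificate `F + Hsos ≥ 0` and the frequencies of `Hsos`
  have hF : ∀ y : ℝ, 0 ≤ Literature.Analysis.SpecialFunctions.reDigammaQuarter y - Real.log Real.pi +
      ((pwCert85.s : ℚ) : ℝ) + cosTransform pwCert85.d.kernelE y -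
        ∑ n ∈ pwCert85.nodeList.toFinset, (fun n : ℕ => ((pwCert85.a n : ℚ) : ℝ)) n * Real.cos (y * Real.log n) +
        pwCert85sos.Hsos y :=
    pwCert85_FH_nonneg
  have hfreq : ∀ pq ∈ ratioClasses pwCert85sos.Np, pwCert85sos.isOut pq.1 pq.2 = true →
      2 * (8 / 5 : ℝ) < |Real.log pq.1 - Real.log pq.2| := by
    intro pq hpq hout
    have h1 := SOSData.Hsos_frequencies pwCert85_sos hpq hout
    have e : ((pwCert85.d.L : ℚ) : ℝ) = 2 * (8 / 5 : ℝ) := by rw [hL]; push_cast; ring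
    rw [e] at h1
    exact h1
  have hs : ((pwCert85.s : ℚ) : ℝ) = 1 := by show (((1 : ℚ)) : ℝ) = 1; norm_num
  have h := neg_slack_le_of_density_add_Hsos_nonneg hg hsupp (PWKernel.continuous_kernelE _)
    (PWKernel.hasCompactSupport_kernelE hh) hEeq ((pwCert85.s : ℚ) : ℝ) pwCert85.nodeList.toFinset
    (fun n : ℕ => ((pwCert85.a n : ℚ) : ℝ)) pwCert85sos hfreq hF
  rw [hs, one_mul] at h
  -- the finite sum as the `tsum` of the route form
  have hts : (∑' n : ℕ, (((fun n : ℕ => (pwCert85.a n : ℝ) * Real.sqrt n / 2) n : ℝ) : ℂ) / (Real.sqrt n : ℂ) *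
      (weilConv g (weilReflect g) (Real.log n) + weilConv g (weilReflect g) (-Real.log n))) =
      ∑ n ∈ pwCert85.nodeList.toFinset, (((pwCert85.a n : ℚ) : ℝ) / 2 : ℝ) *
        (weilConv g (weilReflect g) (Real.log n) + weilConv g (weilReflect g) (-Real.log n)) := by
    have hpt : ∀ n : ℕ, (((fun n : ℕ => (pwCert85.a n : ℝ) * Real.sqrt n / 2) n : ℝ) : ℂ) / (Real.sqrt n : ℂ) =
        ((((pwCert85.a n : ℚ) : ℝ) / 2 : ℝ) : ℂ) := by
      intro n
      rcases Nat.eq_zero_or_pos n with rfl | hn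
      · have h0 : pwCert85.a 0 = 0 := pwCert85_a_eq_zero (by decide)
        simp [h0]
      · have hsq : (Real.sqrt n : ℂ) ≠ 0 := by
          exact_mod_cast (Real.sqrt_pos.2 (by exact_mod_cast hn)).ne'
        field_simp
        push_cast
        ring
    simp_rw [hpt]
    refine tsum_eq_sum fun n hn => ?_
    rw [pwCert85_a_eq_zero hn]
    push_cast
    ring
  rw [hts]
  exact h

/-- The fake weights are non-negative. [folklore] -/
theorem fakeWeight_eight_fifths_nonneg (n : ℕ) : 0 ≤ (pwCert85.a n : ℝ) * Real.sqrt n / 2 := by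
  have := pwCert85_a_nonneg n
  have h1 : (0 : ℝ) ≤ pwCert85.a n := by exact_mod_cast this
  positivity

/-- **The unit-slack sign-cone inequality up to `8/5`, Literature form.** For every finite family of Weil
tests `gᵢ` supported in `[-b, b]`, `b ≤ 8/5`, and `F = Σᵢ gᵢ ⋆ g̃ᵢ` node-nonnegative:
`-Re F(0) ≤ Re W_ar(F)`. [folklore] -/
theorem neg_re_apply_zero_le_re_weilArchPolar_of_tsupport_subset_eight_fifths {b : ℝ} (hb : b ≤ 8 / 5)
    {k : ℕ} {g : Fin k → ℝ → ℂ} {F : ℝ → ℂ} (hF : F = fun t => ∑ i, weilConv (g i) (weilReflect (g i)) t)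
    (hg : ∀ i, IsWeilTest (g i)) (hsupp : ∀ i, tsupport (g i) ⊆ Icc (-b) b)
    (hn : ∀ n : ℕ, 2 ≤ n → 0 ≤ (F (Real.log n)).re) :
    -(F 0).re ≤ (weilPolarTerm F + weilArchTerm F).re :=
  neg_re_apply_zero_le_re_weilArchPolar_of_fakeWeight_unitSlack (b := 8 / 5)
    (c := fun n : ℕ => (pwCert85.a n : ℝ) * Real.sqrt n / 2) fakeWeight_eight_fifths_nonneg fakeWeight_unitSlack_eight_fifths hF hg
    (fun i => (hsupp i).trans (Icc_subset_Icc (neg_le_neg hb) hb)) hn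

/-- **`SignConeInequality` (route target, stmt-RiemannHypothesis-16301) UNCONDITIONALLY for all
cut-offs `a ≤ 8/5`** — the item's body verbatim with the extra hypothesis `a ≤ 8/5`; in the ladder
vocabulary of `Cruxes/SignConeInequality/GradedFamily.lean` this is `SignConeUpTo (8/5)` / `CutoffRung (8/5)`. [folklore] -/
theorem signConeInequality_upTo_eight_fifths :
    ∀ a : ℝ, 0 < a → a ≤ 8 / 5 → ∀ (k : ℕ) (g : Fin k → ℝ → ℂ), (∀ i, (ContDiff ℝ ((⊤ : ℕ∞) : WithTop ℕ∞) (g i) ∧ HasCompactSupport (g i)) ∧ tsupport (g i) ⊆ Set.Icc (-a) a) → let F : ℝ → ℂ := fun t => ∑ i, MeasureTheory.convolution (g i) (fun u => (starRingEnd ℂ) ((g i) (-u))) (ContinuousLinearMap.mul ℂ ℂ) MeasureTheory.MeasureSpace.volume t; (∀ n : ℕ, 2 ≤ n → 0 ≤ (F (Real.log n)).re) → let M : ℂ → ℂ := fun s => ∫ u : ℝ, F u * Complex.exp ((s - 1 / 2) * u); -(F 0).re ≤ (M 0 + M 1 + ((1 / (2 * Real.pi) : ℂ) * (∫ t : ℝ,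 M (1 / 2 + t * Complex.I) * ((Complex.digamma (1 / 4 + t / 2 * Complex.I)).re : ℂ)) - F 0 * (Real.log Real.pi : ℂ))).re := by
  intro a _ha hab k g hg F hn M
  exact neg_re_apply_zero_le_re_weilArchPolar_of_tsupport_subset_eight_fifths (b := a) hab (g := g) (F := F)
    rfl (fun i => (hg i).1) (fun i => (hg i).2) hn

/-- **`SignConeOscillatory` (route crux, stmt-RiemannHypothesis-16302) UNCONDITIONALLY for all
cut-offs `a ≤ 8/5`** — the item's body verbatim with the extra hypothesis `a ≤ 8/5` (previous
rungs: `563/1024` exact cone, `4/5` without primes, `1`, `13/10`, `7/5`, `3/2` with fake primes). [folklore] -/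
theorem signConeOscillatory_upTo_eight_fifths :
    ∀ a : ℝ, 0 < a → a ≤ 8 / 5 → ∀ (k : ℕ) (g : Fin k → ℝ → ℂ), (∀ i, (ContDiff ℝ ((⊤ : ℕ∞) : WithTop ℕ∞) (g i) ∧ HasCompactSupport (g i)) ∧ tsupport (g i) ⊆ Set.Icc (-a) a) → let F : ℝ → ℂ := fun t => ∑ i, MeasureTheory.convolution (g i) (fun u => (starRingEnd ℂ) ((g i) (-u))) (ContinuousLinearMap.mul ℂ ℂ) MeasureTheory.MeasureSpace.volume t; (∀ n : ℕ, 2 ≤ n → 0 ≤ (F (Real.log n)).re) → (∃ t : ℝ, Real.log 2 ≤ |t| ∧ (F t).re < 0) → let M : ℂ → ℂ := fun s => ∫ u : ℝ, F u * Complex.exp ((s - 1 / 2) * u); -(F 0).re ≤ (M 0 + M 1 + ((1 / (2 * Real.pi) : ℂ) * (∫ t : ℝ, M (1 / 2 + t * Complex.I) * ((Complex.digamma (1 / 4 + t / 2 * Complex.I)).re : ℂ)) - F 0 * (Real.log Real.pi : ℂ))).re :=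
  signConeOscillatory_upTo_of_fakeWeight_unitSlack (b := 8 / 5)
    (c := fun n : ℕ => (pwCert85.a n : ℝ) * Real.sqrt n / 2) fakeWeight_eight_fifths_nonneg fakeWeight_unitSlack_eight_fifths

/-- **Registered stub `stub_cutoffRung_eight_fifths` of the crux cell's ladder skeleton** (item
stmt-RiemannHypothesis-16301, `Cruxes/SignConeInequality`, lead's `graded-family.lean`): the rung
`CutoffRung (8/5)` — `SignConeInequality` for every cut-off `a ≤ 8/5`, unconditionally. [folklore] -/
theorem stub_cutoffRung_eight_fifths : ∀ a : ℝ, 0 < a → a ≤ 8 / 5 → ∀ (k : ℕ) (g : Fin k → ℝ → ℂ), (∀ i, (ContDiff ℝ ((⊤ : ℕ∞) : WithTop ℕ∞) (g i) ∧ HasCompactSupport (g i)) ∧ tsupport (g i) ⊆ Set.Icc (-a) a) → let F : ℝ → ℂ := fun t => ∑ i, MeasureTheory.convolution (g i) (fun u => (starRingEnd ℂ) ((g i) (-u))) (ContinuousLinearMap.mul ℂ ℂ) MeasureTheory.MeasureSpace.volume t; (∀ n : ℕ, 2 ≤ n → 0 ≤ (F (Real.log n)).re) → let M : ℂ → ℂ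 := fun s => ∫ u : ℝ, F u * Complex.exp ((s - 1 / 2) * u); -(F 0).re ≤ (M 0 + M 1 + ((1 / (2 * Real.pi) : ℂ) * (∫ t : ℝ, M (1 / 2 + t * Complex.I) * ((Complex.digamma (1 / 4 + t / 2 * Complex.I)).re : ℂ)) - F 0 * (Real.log Real.pi : ℂ))).re :=
  signConeInequality_upTo_eight_fifths

end Summit.RiemannHypothesis.RiemannHypothesis.Theorems.SignCone

end
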